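import Mathlib

/-!
# KontsevichZagierPeriods — kz1p LEMMA CR1 (co-rank ≤ 1 ⇒ the found relation lattice is complete over ℚ), kernel-checked

Cell pub-kz1p, seat b2b-kz1p-2, gen 11 (kz1p v1.2; PROCEDURE.md §3 E1-3; LEAN-IN-TREE rule).  Pure Mathlib mathematics,
no named facts, no new definitions, no `sorry`.

Setting: `s` named points `P i` of an additive commutative group `G` (in kz1p: `E(K)`), the set of their integer
RELATIONS `Rel P = {c : Fin s → ℤ | Σ cᵢ • Pᵢ = 0}`, and a set `F ⊆ Rel P` of relations FOUND (by kz1p's box search,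
each verified exactly by the group law).  With `ι : ℤ^s → ℚ^s` the coordinatewise cast (`(Int.castAddHom ℚ).compLeft (Fin s)`,
written `AddMonoidHom.compLeft (Int.castAddHom ℚ) (Fin s)` below) put `LQ = span_ℚ ι(F)` and `RQ = span_ℚ ι(Rel P)`.

* `exists_int_mul_mem_span_int` : clearing denominators — a vector of `span_ℚ ι(S)`, `S ⊆ ℤ^s`, has a non-zero integer
  multiple in `ι (span_ℤ S)`;
* `relSpan_ne_top` : if some `P i₀` is non-torsion then `RQ ≠ ⊤` (else `N • e_{i₀}` would be a relation, i.e. `N • P i₀ = 0`);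
* `cr1` (LEMMA CR1) : if `s ≤ finrank_ℚ LQ + 1` (co-rank ≤ 1) and some `P i₀` is non-torsion, then `RQ = LQ` — every
  integer relation among the `Pᵢ` is a ℚ-combination of the found ones, so every rank kz1p feeds into the dimension
  formula of [HW Thm 18.9] (computed modulo `F`) is the true rank: "ranks exact" without a descent certificate;
* `cr1_corank_zero` : the co-rank-0 case (found relations of full rank; no non-torsion point needed);
* `cr1_multiple` : the same in lattice form — every relation has a non-zero integer multiple in `span_ℤ F`.

In kz1p (`kz1p/e1.py::_dependencies`, v1.2): `s` = number of named points, `F` = the rows of the exactly verified relation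
lattice (a lattice basis, so `finrank_ℚ LQ = #F`), the non-torsion witness is a named point `P` with `n • P ≠ O` for
`1 ≤ n ≤ B(d)`, `B(d)` the cited torsion bound ([Maz77] for `d = 1`, [Kam92]/[KM88] for `d = 2`), which makes `P` of infinite
order; the lemma is invoked only when `s − #F ≤ 1`.
-/

namespace Summit.KontsevichZagierPeriods.KzOnePeriods.LemmaCR1

open Submodule

variable {G : Type*} [AddCommGroup G] {s : ℕ}

/-- coordinates of `AddMonoidHom.compLeft (Int.castAddHom ℚ) (Fin s) c` -/
lemma iota_apply (c : Fin s → ℤ) (i : Fin s) : (AddMonoidHom.compLeft (Int.castAddHom ℚ) (Fin s)) c i = (c i : ℚ) := by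
  simp [AddMonoidHom.compLeft]

/-- `AddMonoidHom.compLeft (Int.castAddHom ℚ) (Fin s)` turns integer multiples into rational scalar multiples -/
lemma iota_zsmul (n : ℤ) (c : Fin s → ℤ) : (AddMonoidHom.compLeft (Int.castAddHom ℚ) (Fin s)) (n • c) = (n : ℚ) • (AddMonoidHom.compLeft (Int.castAddHom ℚ) (Fin s)) c := by
  funext i; simp

/-- `AddMonoidHom.compLeft (Int.castAddHom ℚ) (Fin s)` is injective -/
lemma iota_injective : Function.Injective (AddMonoidHom.compLeft (Int.castAddHom ℚ) (Fin s)) := by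
  intro c d h; funext i
  have := congrFun h i
  simpa [iota_apply] using this

/-- the relation set contains `0` -/
lemma rel_zero (P : Fin s → G) : (0 : Fin s → ℤ) ∈ {c : Fin s → ℤ | ∑ i, c i • P i = 0} := by
  simp

/-- the relation set is closed under addition -/
lemma rel_add (P : Fin s → G) {c d : Fin s → ℤ} (hc : c ∈ {c : Fin s → ℤ | ∑ i, c i • P i = 0})
    (hd : d ∈ {c : Fin s → ℤ | ∑ i, c i • P i = 0}) : c + d ∈ {c : Fin s → ℤ | ∑ i, c i • P i = 0} := by
  simp only [Set.mem_setOf_eq] at *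
  simp [Pi.add_apply, add_smul, Finset.sum_add_distrib, hc, hd]

/-- the relation set is closed under integer multiples -/
lemma rel_zsmul (P : Fin s → G) (n : ℤ) {c : Fin s → ℤ} (hc : c ∈ {c : Fin s → ℤ | ∑ i, c i • P i = 0}) :
    n • c ∈ {c : Fin s → ℤ | ∑ i, c i • P i = 0} := by
  simp only [Set.mem_setOf_eq] at *
  simp [Pi.smul_apply, mul_smul, ← Finset.smul_sum, hc]

/-- the ℤ-span of the relation set is the relation set itself -/
lemma span_int_rel (P : Fin s → G) :
    (span ℤ {c : Fin s → ℤ | ∑ i, c i • P i = 0} : Set (Fin s → ℤ)) = {c : Fin s → ℤ | ∑ i, c i • P i = 0} := by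
  apply le_antisymm
  · intro x hx
    refine span_induction (p := fun x _ => x ∈ {c : Fin s → ℤ | ∑ i, c i • P i = 0}) (fun x h => h) (rel_zero P)
      (fun x y _ _ hx hy => rel_add P hx hy) (fun a x _ hx => rel_zsmul P a hx) hx
  · exact subset_span

/-- Clearing denominators: an element of the ℚ-span of integer vectors has a non-zero integer multiple in the image of
their ℤ-span. -/
lemma exists_int_mul_mem_span_int (S : Set (Fin s → ℤ)) {x : Fin s → ℚ} (hx : x ∈ span ℚ ((AddMonoidHom.compLeft (Int.castAddHom ℚ) (Fin s)) '' S)) :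
    ∃ N : ℤ, N ≠ 0 ∧ ∃ y ∈ span ℤ S, (AddMonoidHom.compLeft (Int.castAddHom ℚ) (Fin s)) y = (N : ℚ) • x := by
  induction hx using span_induction with
  | mem x h =>
      obtain ⟨c, hc, rfl⟩ := h
      exact ⟨1, one_ne_zero, c, subset_span hc, by simp⟩
  | zero => exact ⟨1, one_ne_zero, 0, zero_mem _, by simp⟩
  | add x y _ _ hx hy =>
      obtain ⟨N₁, hN₁, u, hu, hux⟩ := hx
      obtain ⟨N₂, hN₂, v, hv, hvy⟩ := hy
      refine ⟨N₁ * N₂, mul_ne_zero hN₁ hN₂, N₂ • u + N₁ • v, add_mem (smul_mem _ _ hu) (smul_mem _ _ hv), ?_⟩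
      rw [map_add, iota_zsmul, iota_zsmul, hux, hvy]
      simp only [smul_smul, smul_add, Int.cast_mul]
      ring_nf
  | smul q x _ hx =>
      obtain ⟨N, hN, u, hu, hux⟩ := hx
      refine ⟨N * q.den, mul_ne_zero hN (by exact_mod_cast q.den_nz), q.num • u, smul_mem _ _ hu, ?_⟩
      rw [iota_zsmul, hux, smul_smul, smul_smul]
      congr 1
      push_cast
      have h := Rat.mul_den_eq_num q
      calc (q.num : ℚ) * (N : ℚ) = (q * q.den) * N := by rw [h]
        _ = (N : ℚ) * (q.den : ℚ) * q := by ring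

/-- If some `P i₀` is non-torsion, the ℚ-span of the integer relations is a proper subspace of `ℚ^s`. -/
lemma relSpan_ne_top (P : Fin s → G) {i₀ : Fin s} (hP : ∀ n : ℤ, n ≠ 0 → n • P i₀ ≠ 0) :
    span ℚ ((AddMonoidHom.compLeft (Int.castAddHom ℚ) (Fin s)) '' {c : Fin s → ℤ | ∑ i, c i • P i = 0}) ≠ ⊤ := by
  intro htop
  have hmem : (Pi.single i₀ (1 : ℚ) : Fin s → ℚ) ∈ span ℚ ((AddMonoidHom.compLeft (Int.castAddHom ℚ) (Fin s)) '' {c : Fin s → ℤ | ∑ i, c i • P i = 0}) := by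
    rw [htop]; exact mem_top
  obtain ⟨N, hN, y, hy, hyx⟩ := exists_int_mul_mem_span_int _ hmem
  have hy' : y ∈ {c : Fin s → ℤ | ∑ i, c i • P i = 0} := by
    have : y ∈ (span ℤ {c : Fin s → ℤ | ∑ i, c i • P i = 0} : Set (Fin s → ℤ)) := hy
    rwa [span_int_rel] at this
  -- `y = N • e_{i₀}`
  have hyeq : y = Pi.single i₀ N := by
    apply iota_injective
    rw [hyx]; funext i
    by_cases hi : i = i₀
    · subst hi; simp
    · simp [hi]
  have : (N : ℤ) • P i₀ = 0 := by
    have h := hy'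
    simp only [Set.mem_setOf_eq, hyeq] at h
    rw [Finset.sum_eq_single i₀] at h
    · simpa using h
    · intro b _ hb; simp [hb]
    · intro h0; exact absurd (Finset.mem_univ i₀) h0
  exact hP N hN this

/-- **LEMMA CR1** (co-rank ≤ 1).  If the found relations `F` span a ℚ-subspace of dimension ≥ `s − 1` and some named point is
non-torsion, then EVERY integer relation among the `Pᵢ` lies in the ℚ-span of the found ones. -/
theorem cr1 (P : Fin s → G) (F : Set (Fin s → ℤ)) (hF : F ⊆ {c : Fin s → ℤ | ∑ i, c i • P i = 0})
    (hrank : s ≤ Module.finrank ℚ (span ℚ ((AddMonoidHom.compLeft (Int.castAddHom ℚ) (Fin s)) '' F)) + 1)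
    {i₀ : Fin s} (hP : ∀ n : ℤ, n ≠ 0 → n • P i₀ ≠ 0) :
    span ℚ ((AddMonoidHom.compLeft (Int.castAddHom ℚ) (Fin s)) '' {c : Fin s → ℤ | ∑ i, c i • P i = 0}) = span ℚ ((AddMonoidHom.compLeft (Int.castAddHom ℚ) (Fin s)) '' F) := by
  have hle : span ℚ ((AddMonoidHom.compLeft (Int.castAddHom ℚ) (Fin s)) '' F) ≤ span ℚ ((AddMonoidHom.compLeft (Int.castAddHom ℚ) (Fin s)) '' {c : Fin s → ℤ | ∑ i, c i • P i = 0}) :=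
    span_mono (Set.image_mono hF)
  have hlt : span ℚ ((AddMonoidHom.compLeft (Int.castAddHom ℚ) (Fin s)) '' {c : Fin s → ℤ | ∑ i, c i • P i = 0}) < ⊤ :=
    lt_top_iff_ne_top.mpr (relSpan_ne_top P hP)
  have h1 : Module.finrank ℚ (span ℚ ((AddMonoidHom.compLeft (Int.castAddHom ℚ) (Fin s)) '' {c : Fin s → ℤ | ∑ i, c i • P i = 0}))
      < Module.finrank ℚ (Fin s → ℚ) := by
    have := Submodule.finrank_lt_finrank_of_lt hlt
    simpa using this
  have h2 : Module.finrank ℚ (Fin s → ℚ) = s := by simp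
  have h3 : Module.finrank ℚ (span ℚ ((AddMonoidHom.compLeft (Int.castAddHom ℚ) (Fin s)) '' {c : Fin s → ℤ | ∑ i, c i • P i = 0}))
      ≤ Module.finrank ℚ (span ℚ ((AddMonoidHom.compLeft (Int.castAddHom ℚ) (Fin s)) '' F)) := by omega
  exact (Submodule.eq_of_le_of_finrank_le hle h3).symm

/-- Co-rank 0: if the found relations already have full rank `s`, both spans are all of `ℚ^s` (every named point is
torsion); no non-torsion hypothesis is needed. -/
theorem cr1_corank_zero (P : Fin s → G) (F : Set (Fin s → ℤ)) (hF : F ⊆ {c : Fin s → ℤ | ∑ i, c i • P i = 0})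
    (hrank : s ≤ Module.finrank ℚ (span ℚ ((AddMonoidHom.compLeft (Int.castAddHom ℚ) (Fin s)) '' F))) :
    span ℚ ((AddMonoidHom.compLeft (Int.castAddHom ℚ) (Fin s)) '' {c : Fin s → ℤ | ∑ i, c i • P i = 0}) = span ℚ ((AddMonoidHom.compLeft (Int.castAddHom ℚ) (Fin s)) '' F) := by
  have hle : span ℚ ((AddMonoidHom.compLeft (Int.castAddHom ℚ) (Fin s)) '' F) ≤ span ℚ ((AddMonoidHom.compLeft (Int.castAddHom ℚ) (Fin s)) '' {c : Fin s → ℤ | ∑ i, c i • P i = 0}) :=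
    span_mono (Set.image_mono hF)
  have hs : Module.finrank ℚ (Fin s → ℚ) = s := by simp
  have htop : span ℚ ((AddMonoidHom.compLeft (Int.castAddHom ℚ) (Fin s)) '' F) = ⊤ := by
    apply Submodule.eq_top_of_finrank_eq
    apply le_antisymm
    · exact Submodule.finrank_le _
    · omega
  apply le_antisymm
  · rw [htop]; exact le_top
  · exact hle

/-- Corollary in the form kz1p uses: every integer relation has a non-zero integer multiple in the ℤ-span of the found
ones (so ranks computed modulo `F` are the true ranks). -/
theorem cr1_multiple (P : Fin s → G) (F : Set (Fin s → ℤ)) (hF : F ⊆ {c : Fin s → ℤ | ∑ i, c i • P i = 0})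
    (hrank : s ≤ Module.finrank ℚ (span ℚ ((AddMonoidHom.compLeft (Int.castAddHom ℚ) (Fin s)) '' F)) + 1)
    {i₀ : Fin s} (hP : ∀ n : ℤ, n ≠ 0 → n • P i₀ ≠ 0) {c : Fin s → ℤ}
    (hc : c ∈ {c : Fin s → ℤ | ∑ i, c i • P i = 0}) :
    ∃ N : ℤ, N ≠ 0 ∧ N • c ∈ span ℤ F := by
  have hcQ : (AddMonoidHom.compLeft (Int.castAddHom ℚ) (Fin s)) c ∈ span ℚ ((AddMonoidHom.compLeft (Int.castAddHom ℚ) (Fin s)) '' F) := by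
    rw [← cr1 P F hF hrank hP]; exact subset_span ⟨c, hc, rfl⟩
  obtain ⟨N, hN, y, hy, hyc⟩ := exists_int_mul_mem_span_int F hcQ
  refine ⟨N, hN, ?_⟩
  have : y = N • c := iota_injective (by rw [hyc, iota_zsmul])
  rwa [this] at hy

end Summit.KontsevichZagierPeriods.KzOnePeriods.LemmaCR1
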